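import Literature.AnabelianGeometry.EtaleTheta.Discharge.Sec1CyclotomicPackageOfClosure
import Literature.AnabelianGeometry.EtaleTheta.Discharge.Sec1DeltaYEllClosureOfDeltaTheta
import Literature.AnabelianGeometry.EtaleTheta.Discharge.Sec1ClosureDeltaYZHat
import Literature.AnabelianGeometry.EtaleTheta.CyclotomeZHatEquiv
import Literature.AnabelianGeometry.SemiGraphs.OncePuncturedTemperedGroupWitness
import Literature.AnabelianGeometry.SemiGraphs.TemperedCyclotomicClosures
import HarnessLib

/-!
# [EtTh] §1 p. 12: the typed cyclotomic package `Δ_Θ ≅ Ẑ(1)`, `1 → Ẑ(1) → Δ^ell_X → Ẑ → 1`,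
# `(Δ^tp_Y)^ell ≅ Ẑ(1)` HOLDS for every datum over a field with trivial absolute Galois group —
# and is non-vacuously MODEL-WITNESSED (FACT-LIST F-0657 / F-0658 / F-0659 / F-1697)

Mochizuki, *The étale theta function and its Frobenioid-theoretic manifestations*, Publ. RIMS **45** (2009)
[EtTh], §1, PRIMS PDF p. 12 (printed p. 238): "we have a natural exact sequence `1 → Ẑ(1) → Δ^ell_X → Ẑ → 1` …
`(Ẑ(1) ≅) Δ_Θ ⊆ Δ^Θ_X` … Thus, `(Δ^tp_Y)^ell ≅ Ẑ(1)`" [cite: MochizukiEtTh2009, §1 p.12] — typed by abc-iut-L3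
(`SemiGraphs/TemperedCyclotomic.lean`) as the predicates `DeltaEllExtension Ω` (FACT-LIST F-0657),
`DeltaThetaIsoTate Ω` (F-0658), `DeltaYEllIsoTate Ω` (F-0659), `DeltaYEllClosureIsoTate Ω` (F-1697) on the origin
binder `Ω : TemperedPiOrigin K`; "is `Ẑ(1)`" is the level-wise `IsTateTwist`: compatible, jointly injective
continuous surjections `T ↠ μ_n(K̄)` that are `Π^tp_X`-equivariant for `G_K` acting on `μ_n(K̄) ⊆ K̄`.

abc-iut cell, block F (FACT-PROVING WAVE), seat abc-iut-f-172 (gen 3); PROOF-ONLY (no `def`, no `instance`, no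
named fact; nothing of another seat restated — abc-iut-L2-t7's `DeltaEllZHat.nonempty_mulEquiv_zHat_of_coe_eq_closure`
(`T ≃* Ẑ` for the F-1697 carrier, every datum), abc-iut-f-172 gen 2's `OncePuncturedCyclotomic.exists_closed_stable_closureDeltaY`
and `cyclotomicPackage_of_deltaYEllClosureIsoTate`, abc-iut-w4-d024/w5-d091's cyclotome generator
`cyclotome.exists_generator`, abc-iut-w6-d060's `OncePuncturedTemperedGroup.conjDeltaEll_eq_self_of_mem_delta` and
abc-iut-w5-d218's kernel inhabitant `OncePuncturedTemperedGroup.nonempty_model_of_isAlgClosed` are consumed BY NAME).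

WHAT IS PROVED (`K : Type`, characteristic `0`).
* `exists_isTateTwist_closureDeltaY_of_subsingleton` — if the absolute Galois group `G_K = Gal(K̄/K)` is TRIVIAL
  (e.g. `K` algebraically closed), then for EVERY `D : OncePuncturedTemperedGroup K` the closure of the image of
  `Δ^tp_Y` in `Δ^ell_X` is a closed `Π^tp_X`-stable Tate twist: the level maps are `t ↦ ξ_n ^ (log_n t)` for a
  compatible system `ξ` of primitive roots of unity of `K̄` and the discrete logarithms `log_n = level_n ∘ e` of an
  abstract isomorphism `e : T ≃* Ẑ`; their kernels are the images of the `n`-th power maps of the compact group `T`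
  (closed of finite index, hence open); equivariance holds because `Π^tp_X = Δ^tp_X` acts trivially on `Δ^ell_X`
  (abc-iut-w6-d060's `conjDeltaEll_eq_self_of_mem_delta`) and `G_K = 1` acts trivially on `μ_n(K̄)`.
* `cyclotomicPackage_of_subsingleton`, `cyclotomicPackage_of_isAlgClosed` — hence ALL FOUR typed predicates hold for
  EVERY origin binder `Ω` over such a field (through gen 2's reductions);
* `exists_inhabited_origin_cyclotomicPackage` — **non-vacuous model witness**: over an algebraically closed field of
  characteristic `0` there is an origin binder `Ω` with an inhabitant (abc-iut-w5-d218's `Π = F̂₂ ×_Ẑ ℤ`; indeed with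
  EVERY datum declared an origin) at which `DeltaYEllClosureIsoTate Ω ∧ DeltaEllExtension Ω ∧ DeltaThetaIsoTate Ω ∧
  DeltaYEllIsoTate Ω`.

HONEST FRAMING. Together with abc-iut-w6-d060's `¬∀` (`TemperedCyclotomicClosures.lean`: a `ℚ₃`-datum with inner
`Π^tp_X`-action violates the package because `G_{ℚ₃}` moves `μ₄`) this LOCATES the content of the four FACT-LIST rows in
the kernel: their group-theoretic part holds for every datum, and what remains is exactly the `G_K`-equivariance
clause (the cyclotomic character), invisible when `G_K = 1`. A model / a degenerate-field instance is CONSISTENCY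
EVIDENCE for the typed package, not a proof of the universal closure (refuted as a schema) and not a statement about
the tempered fundamental group of a curve; [EtTh] is refereed and nothing of it is asserted or disputed here; nothing
bears on [IUTchIII] Cor. 3.12; typed ≠ proved; no side is taken on any disputed claim.
-/

noncomputable section

namespace Literature.AnabelianGeometry.EtaleTheta

open Literature.AnabelianGeometry.SemiGraphs
open _root_.Topology
open scoped commutatorElement
open CategoryTheory ProfiniteGrp ProfiniteGrp.ProfiniteCompletion

namespace OncePuncturedCyclotomic

variable {K : Type} [Field K] (D : OncePuncturedTemperedGroup K)

/-- **The typed "`(Δ^tp_Y)^ell ≅ Ẑ(1)`" / "`1 → Ẑ(1) → Δ^ell_X → …`" holds for EVERY datum when `G_K = 1`**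
([EtTh] p. 12, FACT-LIST F-1697, body). Let `K` have characteristic `0` and trivial absolute Galois group. For every
`D : OncePuncturedTemperedGroup K` there is a closed `Π^tp_X`-stable subgroup `T ≤ Δ^ell_X` whose carrier is the
closure of the image of `Δ^tp_Y` and which is a Tate twist `Ẑ(1)` (`IsTateTwist`). PROOF. `T :=` the kernel of the
canonical `Λ̄ : Δ^ell_X ↠ Ẑ` (gen 2's `exists_closed_stable_closureDeltaY`); `e : T ≃* Ẑ` as abstract groups
(abc-iut-L2-t7); `ξ = (ξ_n)_n` a compatible system of PRIMITIVE roots of unity of `K̄` (`cyclotome.exists_generator`,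
`K̄` separably closed of characteristic `0`); level maps `ι_n(t) := ξ_n ^ (level_n (e t))`. Torsion, compatibility
(`ξ_{nm}^m = ξ_n`, `level_{nm} ≡ level_n (mod n)`) and surjectivity onto `μ_n(K̄) = ⟨ξ_n⟩` are formal; joint
injectivity is `Ẑ → lim_n ℤ/n` injective (`ZHatLevel.ext_of_level`); `Ker ι_n = Ker(level_n ∘ e)` is the image
of the `n`-th power map of `T` (`Ker(Ẑ → ℤ/n) = Ẑ^n`), a continuous image of the compact `T`, hence CLOSED, and of
finite index, hence OPEN; equivariance: `aug g = 1` forces `g ∈ Δ^tp_X`, which acts trivially on `Δ^ell_X`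
(abc-iut-w6-d060's `conjDeltaEll_eq_self_of_mem_delta`), while `G_K = 1` fixes `ι_n(t) ∈ K̄`. [cite: MochizukiEtTh2009, §1 p.12] -/
theorem exists_isTateTwist_closureDeltaY_of_subsingleton [CharZero K]
    [Subsingleton (Field.absoluteGaloisGroup K)] :
    ∃ (T : Subgroup D.DeltaEll) (hT : ∀ g, ∀ t ∈ T, D.conjDeltaEll g t ∈ T),
      IsClosed (T : Set D.DeltaEll) ∧ D.IsTateTwist T D.conjDeltaEll hT ∧
      (T : Set D.DeltaEll) = closure ((fun δ : D.delta =>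
        (QuotientGroup.mk ⟨D.toHat δ, Subgroup.le_topologicalClosure _ ⟨δ, δ.2, rfl⟩⟩ : D.DeltaEll)) ''
          {δ | (δ : D.Pi) ∈ D.piY}) := by
  classical
  obtain ⟨T, hT, hTc, hTset⟩ := exists_closed_stable_closureDeltaY D
  refine ⟨T, hT, hTc, ?_, hTset⟩
  -- topology: `Δ^ell_X` is compact Hausdorff, `T` is compact
  haveI : CompactSpace D.PiHat := D.isProfiniteCompletion_toHat.compactSpace
  haveI : T2Space D.PiHat := D.isProfiniteCompletion_toHat.t2Space
  haveI : CompactSpace ↥D.deltaHat := isCompact_iff_compactSpace.mp D.isClosed_deltaHat.isCompact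
  haveI : IsClosed ((D.ellKerHat.subgroupOf D.deltaHat : Subgroup ↥D.deltaHat) : Set ↥D.deltaHat) :=
    (Subgroup.isClosed_topologicalClosure _).preimage continuous_subtype_val
  haveI : CompactSpace ↥T := isCompact_iff_compactSpace.mp hTc.isCompact
  -- `e : T ≃* Ẑ` (abstract groups)
  obtain ⟨e⟩ := DeltaEllZHat.nonempty_mulEquiv_zHat_of_coe_eq_closure D T hTset
  -- a compatible system of primitive roots of unity of `K̄`
  haveI : CharZero (AlgebraicClosure K) :=
    charZero_of_injective_algebraMap (algebraMap K (AlgebraicClosure K)).injective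
  obtain ⟨ξ, hξ⟩ := cyclotome.exists_generator
    (cyclotome.exists_isPrimitiveRoot_of_isSepClosed (AlgebraicClosure K))
  -- the discrete logarithms `log_N := level_N ∘ e : T → ℤ/N`
  let lg : ∀ N : ℕ+, ↥T →* Multiplicative (ZMod N) := fun N => (ZHatLevel.level N).comp e.toMonoidHom
  have hlg : ∀ (N : ℕ+) (t : ↥T), lg N t = ZHatLevel.level N (e t) := fun N t => rfl
  -- the level maps `ι'_N (t) := ξ_N ^ log_N t`
  let ι' : ∀ N : ℕ+, ↥T →* (AlgebraicClosure K)ˣ := fun N =>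
    { toFun := fun t => (ξ : ℕ+ → (AlgebraicClosure K)ˣ) N ^ (Multiplicative.toAdd (lg N t)).val
      map_one' := by rw [map_one, toAdd_one, ZMod.val_zero, pow_zero]
      map_mul' := fun s t => by
        rw [map_mul, toAdd_mul, ← pow_add]
        refine cyclotome.pow_val_eq_pow_of_mod_eq (cyclotome.pow_eq_one ξ N) ?_
        rw [ZMod.val_add, Nat.mod_mod] }
  have hι' : ∀ (N : ℕ+) (t : ↥T),
      ι' N t = (ξ : ℕ+ → (AlgebraicClosure K)ˣ) N ^ (Multiplicative.toAdd (lg N t)).val := fun N t => rfl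
  -- `ι'_N t = 1 ↔ log_N t = 0`
  have hker : ∀ (N : ℕ+) (t : ↥T), ι' N t = 1 ↔ lg N t = 1 := by
    intro N t
    haveI : NeZero (N : ℕ) := ⟨N.ne_zero⟩
    rw [hι']
    constructor
    · intro h
      have hdvd := ((hξ N).pow_eq_one_iff_dvd _).mp h
      have hlt : (Multiplicative.toAdd (lg N t)).val < (N : ℕ) := ZMod.val_lt _
      have h0 : (Multiplicative.toAdd (lg N t)).val = 0 := Nat.eq_zero_of_dvd_of_lt hdvd hlt
      rw [ZMod.val_eq_zero] at h0
      rw [← ofAdd_toAdd (lg N t), h0, ofAdd_zero]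
    · intro h
      rw [h, toAdd_one, ZMod.val_zero, pow_zero]
  -- `log_N t = 0 ↔ t` is an `N`-th power in `T`
  have hpow : ∀ (N : ℕ+) (t : ↥T), lg N t = 1 ↔ ∃ s : ↥T, s ^ (N : ℕ) = t := by
    intro N t
    rw [hlg, ZHatLevel.level_eq_one_iff_exists_pow]
    constructor
    · rintro ⟨z, hz⟩
      refine ⟨e.symm z, e.injective ?_⟩
      rw [map_pow, MulEquiv.apply_symm_apply, hz]
    · rintro ⟨s, rfl⟩
      exact ⟨e s, (map_pow e s N).symm⟩
  -- the `ℕ`-indexed family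
  let ι : ℕ → (↥T →* (AlgebraicClosure K)ˣ) := fun n => if h : 0 < n then ι' (Nat.toPNat n h) else 1
  have hι : ∀ N : ℕ+, ι (N : ℕ) = ι' N := fun N => by
    simp only [ι, dif_pos N.pos]
    rfl
  refine ⟨ι, ?_, ?_, ?_, ?_, ?_, ?_⟩
  · -- `(ι_n t)^n = 1`
    intro n hn t
    obtain ⟨N, rfl⟩ : ∃ N : ℕ+, (N : ℕ) = n := ⟨Nat.toPNat n hn, rfl⟩
    rw [hι, hι', pow_right_comm, cyclotome.pow_eq_one ξ N, one_pow]
  · -- surjective onto `μ_n(K̄)`: every `n`-th root of unity is a power of the primitive `ξ_n`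
    intro n hn ζ hζ
    obtain ⟨N, rfl⟩ : ∃ N : ℕ+, (N : ℕ) = n := ⟨Nat.toPNat n hn, rfl⟩
    haveI : NeZero (N : ℕ) := ⟨N.ne_zero⟩
    obtain ⟨i, hi, rfl⟩ := (hξ N).eq_pow_of_mem_rootsOfUnity (ξ := ζ) (by rwa [mem_rootsOfUnity])
    refine ⟨e.symm (ZHatLevel.eta i), ?_⟩
    rw [hι, hι', hlg, MulEquiv.apply_symm_apply, ZHatLevel.level_eta, toAdd_ofAdd, Int.cast_natCast,
      ZMod.val_natCast, Nat.mod_eq_of_lt hi]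
  · -- open kernels: `Ker ι_n` is the image of the `n`-th power map — closed, of finite index
    intro n hn
    obtain ⟨N, rfl⟩ : ∃ N : ℕ+, (N : ℕ) = n := ⟨Nat.toPNat n hn, rfl⟩
    haveI : NeZero (N : ℕ) := ⟨N.ne_zero⟩
    have hset : ((ι N).ker : Set ↥T) = ((lg N).ker : Set ↥T) := by
      ext t
      rw [SetLike.mem_coe, SetLike.mem_coe, MonoidHom.mem_ker, MonoidHom.mem_ker, hι, hker]
    have hrange : ((lg N).ker : Set ↥T) = Set.range fun s : ↥T => s ^ (N : ℕ) := by
      ext t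
      rw [SetLike.mem_coe, MonoidHom.mem_ker, hpow, Set.mem_range]
    have hclosed : IsClosed ((lg N).ker : Set ↥T) := by
      rw [hrange]
      exact (isCompact_range (continuous_pow (N : ℕ))).isClosed
    haveI : (lg N).ker.FiniteIndex := inferInstance
    rw [hset]
    exact Subgroup.isOpen_of_isClosed_of_finiteIndex _ hclosed
  · -- compatibility `(ι_{nm} t)^m = ι_n t`
    intro n m hn hm t
    obtain ⟨N, rfl⟩ : ∃ N : ℕ+, (N : ℕ) = n := ⟨Nat.toPNat n hn, rfl⟩
    obtain ⟨M, rfl⟩ : ∃ M : ℕ+, (M : ℕ) = m := ⟨Nat.toPNat m hm, rfl⟩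
    haveI : NeZero (N : ℕ) := ⟨N.ne_zero⟩
    rw [← PNat.mul_coe, hι, hι, hι', hι', pow_right_comm, cyclotome.pow_apply_mul]
    refine cyclotome.pow_val_eq_pow_of_mod_eq (cyclotome.pow_eq_one ξ N) ?_
    have hc := ZHatLevel.cast_level_mul N M (e t)
    rw [ZMod.castHom_apply, ZMod.cast_eq_val] at hc
    rw [hlg, hlg, ← hc, ZMod.val_natCast]
    exact (Nat.mod_mod _ _).symm
  · -- jointly injective: `Ẑ ↪ lim_n ℤ/n`
    intro t ht
    have h1 : e t = 1 := by
      refine ZHatLevel.ext_of_level fun N => ?_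
      rw [map_one, ← hlg, ← hker, ← hι]
      exact ht N N.pos
    exact (map_eq_one_iff e e.injective).mp h1
  · -- equivariance: both sides are `ι_n t`
    intro n hn g t
    have hg : g ∈ D.delta := by
      rw [TemperedArithmeticGroup.mem_delta_iff]; exact Subsingleton.elim _ _
    have hgt : (⟨D.conjDeltaEll g t, hT g t t.2⟩ : ↥T) = t :=
      Subtype.ext (D.conjDeltaEll_eq_self_of_mem_delta hg t)
    rw [hgt, Subsingleton.elim (D.aug g) 1]
    rfl

/-- **The typed F-1697 `DeltaYEllClosureIsoTate Ω` holds for EVERY origin binder `Ω` over a field of characteristic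
`0` with trivial absolute Galois group** ([EtTh] p. 12 "`(Δ^tp_Y)^ell ≅ Ẑ(1)`"; an instance class of the schema,
whose universal closure over all fields is refuted). [cite: MochizukiEtTh2009, §1 p.12] -/
theorem deltaYEllClosureIsoTate_of_subsingleton [CharZero K] [Subsingleton (Field.absoluteGaloisGroup K)]
    (Ω : TemperedPiOrigin K) :
    Literature.AnabelianGeometry.SemiGraphs.OncePuncturedTemperedGroup.DeltaYEllClosureIsoTate Ω :=
  fun D _ => exists_isTateTwist_closureDeltaY_of_subsingleton D

/-- **The whole typed [EtTh] p. 12 cyclotomic package — F-1697, F-0657, F-0658, F-0659 — holds for EVERY origin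
binder over a field of characteristic `0` with trivial absolute Galois group**: `DeltaYEllClosureIsoTate Ω`,
`DeltaEllExtension Ω` ("`1 → Ẑ(1) → Δ^ell_X → Ẑ → 1`"), `DeltaThetaIsoTate Ω` ("`Δ_Θ ≅ Ẑ(1)`") and
`DeltaYEllIsoTate Ω` ("`(Δ^tp_Y)^ell ≅ Ẑ(1)`"), the last three through abc-iut-f-172 gen 2's reductions
(`cyclotomicPackage_of_deltaYEllClosureIsoTate`). [cite: MochizukiEtTh2009, §1 p.12] -/
theorem cyclotomicPackage_of_subsingleton [CharZero K] [Subsingleton (Field.absoluteGaloisGroup K)]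
    (Ω : TemperedPiOrigin K) :
    Literature.AnabelianGeometry.SemiGraphs.OncePuncturedTemperedGroup.DeltaYEllClosureIsoTate Ω ∧
      Literature.AnabelianGeometry.SemiGraphs.OncePuncturedTemperedGroup.DeltaEllExtension Ω ∧
      Literature.AnabelianGeometry.SemiGraphs.OncePuncturedTemperedGroup.DeltaThetaIsoTate Ω ∧
      Literature.AnabelianGeometry.SemiGraphs.OncePuncturedTemperedGroup.DeltaYEllIsoTate Ω :=
  have h := deltaYEllClosureIsoTate_of_subsingleton Ω
  ⟨h, cyclotomicPackage_of_deltaYEllClosureIsoTate Ω h⟩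

/-- For `K` algebraically closed the absolute Galois group `Gal(K̄/K)` is trivial (`K → K̄` is onto, so every
`K`-automorphism of `K̄` is the identity). [cite: MochizukiEtTh2009, §1 p.12] -/
theorem subsingleton_absoluteGaloisGroup_of_isAlgClosed (K : Type) [Field K] [IsAlgClosed K] :
    Subsingleton (Field.absoluteGaloisGroup K) := by
  refine ⟨fun σ τ => AlgEquiv.ext fun x => ?_⟩
  obtain ⟨k, rfl⟩ :=
    (IsAlgClosed.algebraMap_bijective_of_isIntegral (k := K) (K := AlgebraicClosure K)).2 x
  rw [AlgEquiv.commutes, AlgEquiv.commutes]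

/-- **Over an algebraically closed field of characteristic `0` the typed [EtTh] p. 12 cyclotomic package holds for
every origin binder** (F-1697 ∧ F-0657 ∧ F-0658 ∧ F-0659 as typed). [cite: MochizukiEtTh2009, §1 p.12] -/
theorem cyclotomicPackage_of_isAlgClosed (K : Type) [Field K] [IsAlgClosed K] [CharZero K]
    (Ω : TemperedPiOrigin K) :
    Literature.AnabelianGeometry.SemiGraphs.OncePuncturedTemperedGroup.DeltaYEllClosureIsoTate Ω ∧
      Literature.AnabelianGeometry.SemiGraphs.OncePuncturedTemperedGroup.DeltaEllExtension Ω ∧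
      Literature.AnabelianGeometry.SemiGraphs.OncePuncturedTemperedGroup.DeltaThetaIsoTate Ω ∧
      Literature.AnabelianGeometry.SemiGraphs.OncePuncturedTemperedGroup.DeltaYEllIsoTate Ω :=
  haveI := subsingleton_absoluteGaloisGroup_of_isAlgClosed K
  cyclotomicPackage_of_subsingleton Ω

/-- **Non-vacuous MODEL WITNESS of the typed [EtTh] p. 12 cyclotomic package** (FACT-LIST F-0657 / F-0658 / F-0659 /
F-1697): over any algebraically closed field `K` of characteristic `0` there is an origin binder `Ω` — the one
declaring EVERY datum an origin — which is INHABITED (abc-iut-w5-d218's kernel inhabitant `Π = F̂₂ ×_Ẑ ℤ` of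
`OncePuncturedTemperedGroup K`) and at which `DeltaYEllClosureIsoTate Ω`, `DeltaEllExtension Ω`,
`DeltaThetaIsoTate Ω` and `DeltaYEllIsoTate Ω` all hold. Consistency evidence for the typed package (its universal
closure over all fields is refuted as a schema, abc-iut-w6-d060); not the tempered fundamental group of a curve.
[cite: MochizukiEtTh2009, §1 p.12] -/
theorem exists_inhabited_origin_cyclotomicPackage (K : Type) [Field K] [IsAlgClosed K] [CharZero K] :
    ∃ Ω : TemperedPiOrigin K, (∃ D : OncePuncturedTemperedGroup K, Ω.IsTateOrigin D) ∧
      (∀ D : OncePuncturedTemperedGroup K, Ω.IsTateOrigin D) ∧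
      Literature.AnabelianGeometry.SemiGraphs.OncePuncturedTemperedGroup.DeltaYEllClosureIsoTate Ω ∧
      Literature.AnabelianGeometry.SemiGraphs.OncePuncturedTemperedGroup.DeltaEllExtension Ω ∧
      Literature.AnabelianGeometry.SemiGraphs.OncePuncturedTemperedGroup.DeltaThetaIsoTate Ω ∧
      Literature.AnabelianGeometry.SemiGraphs.OncePuncturedTemperedGroup.DeltaYEllIsoTate Ω := by
  obtain ⟨D⟩ := OncePuncturedTemperedGroup.nonempty_model_of_isAlgClosed K
  exact ⟨⟨fun _ => True, fun _ => True, fun _ _ => trivial⟩, ⟨D, trivial⟩, fun _ => trivial,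
    cyclotomicPackage_of_isAlgClosed K _⟩

end OncePuncturedCyclotomic

end Literature.AnabelianGeometry.EtaleTheta

end
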